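import Literature.Geometry.Riemannian.RicciFlowPICProofs
import Literature.Geometry.Riemannian.PinchingEstimatesReduction4
import HarnessLib

/-!
# The constants of Chen–Zhu's Lemma 2.1 at `t = 0`: the two compactness statements
(topic `Geometry/Riemannian`)

Part of the decomposition of `Literature.Geometry.Riemannian.hamilton_chenZhu_pinching`
(`PinchingEstimates.lean`). Hamilton 1997, §2.1, p. 8: "Note that if `M⁴` is compact and
`a₁ + a₂ > 0` and `c₁ + c₂ > 0` at `t = 0`, there is some constant `Λ` so that the estimate
indeed holds at `t = 0`"; p. 17: "we start with initial control on `max(|A|, |B|, |C|)` and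
`min(a₁ + a₂, c₁ + c₂)` … since `M` is compact". PROVED here, the two compactness hypotheses
(`hbd`, `hpic`) of the reduction `hamilton_chenZhu_pinching_of_ode₄`
(`PinchingEstimatesReduction4.lean`), by the uniform-positivity principle
`exists_pos_le_curvatureFunctional` (`OrthonormalFrameBounds.lean`) and the uniform PIC bound
`exists_pos_le_twoSmallestEigenvaluesSum_blocks` (`RicciFlowPICProofs.lean`) of the tree,
transferred between Levi-Civita connections by `IsLeviCivita.curvature_eq_riemann`:

* `exists_blocks_bound` — on a compact Riemannian manifold there is `K₀ ≥ 0` bounding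
  `|uᵀAv|, |uᵀBv|, |uᵀCv|` over all orthonormal frames and unit `u, v` (functional
  `1/(1 + |uᵀAv| + |uᵀBv| + |uᵀCv|)`);
* `exists_pic_bound` — on a compact PIC manifold there is `m > 0` with `a₁ + a₂ ≥ m`,
  `c₁ + c₂ ≥ m` in every orthonormal frame, for every Levi-Civita connection;
* `hamilton_chenZhu_pinching_of_ode₂` — the reduction with these two hypotheses discharged:
  `hamilton_chenZhu_pinching` follows from the maximum principle for the curvature ODE and
  the ODE parts of Hamilton's improving estimates (Thm. 2.1 with Lemma 2.2, Thm. 2.3).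

## References

* R. S. Hamilton, Comm. Anal. Geom. 5 (1997), §2.1, p. 8 and §2.2, p. 17. [Hamilton1997]
* B.-L. Chen, X.-P. Zhu, J. Differential Geom. 74 (2006), §2, Lemma 2.1. [ChenZhu2006]
-/

noncomputable section

open Set Real Function
open scoped Manifold ContDiff Topology Matrix BigOperators

namespace Literature.Geometry.Riemannian

open Lorentzian Lorentzian.PseudoRiemannianMetric HamiltonODE

section General

variable {E : Type*} [NormedAddCommGroup E] [NormedSpace ℝ E] {H : Type*} [TopologicalSpace H]
  {I : ModelWithCorners ℝ E H} {M : Type*} [TopologicalSpace M] [ChartedSpace H M]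
  [IsManifold I ∞ M] [FiniteDimensional ℝ E] [CompleteSpace E] [T2Space M] [CompactSpace M]
  [LocallyCompactSpace M]
  {g : PseudoRiemannianMetric I ∞ E (TangentSpace I : M → Type _)}

omit [T2Space M] [CompactSpace M] [LocallyCompactSpace M] in
/-- The blocks of the curvature do not depend on the choice of Levi-Civita connection. [folklore] -/
theorem blocks_eq_of_isLeviCivita {cov cov' : CovariantDerivative I E (TangentSpace I : M → Type _)}
    (hcov : g.IsLeviCivita cov) (hcov' : g.IsLeviCivita cov') (x : M) (e : Fin 4 → TangentSpace I x) :
    g.blockA cov' x e = g.blockA cov x e ∧ g.blockB cov' x e = g.blockB cov x e ∧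
      g.blockC cov' x e = g.blockC cov x e := by
  have hn : (2 : ℕ∞ω) ≤ ∞ := WithTop.coe_le_coe.mpr le_top
  haveI := g.hasLeviCivita
  have hcurv : cov'.curvature x = cov.curvature x := by
    rw [hcov'.curvature_eq_riemann hn x, hcov.curvature_eq_riemann hn x]
  simp only [blockA, blockB, blockC, pairingCurvature, bivectorCurvature, curvatureForm, hcurv, and_self]

/-- **Uniform bound on the curvature blocks of a compact Riemannian manifold** with respect to a
given Levi-Civita connection. [cite: Hamilton1997, §2.2, p. 17] -/
theorem exists_blocks_bound_with {cov : CovariantDerivative I E (TangentSpace I : M → Type _)}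
    (hg : g.IsRiemannian) (hcov : g.IsLeviCivita cov) :
    ∃ K₀ : ℝ, 0 ≤ K₀ ∧ ∀ (x : M) (e : Fin 4 → TangentSpace I x), g.IsOrthonormalFrame x e →
      ∀ u v : Fin 3 → ℝ, u ⬝ᵥ u = 1 → v ⬝ᵥ v = 1 →
        |u ⬝ᵥ (g.blockA cov x e *ᵥ v)| ≤ K₀ ∧ |u ⬝ᵥ (g.blockB cov x e *ᵥ v)| ≤ K₀ ∧
          |u ⬝ᵥ (g.blockC cov x e *ᵥ v)| ≤ K₀ := by
  -- index tables of Hamilton's bases (as in `exists_pos_le_twoSmallestEigenvaluesSum_blocks`)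
  set σ₁ : Fin 3 → Fin 2 → Fin 4 := ![![0, 2], ![0, 3], ![0, 1]] with hσ₁
  set σ₂ : Fin 3 → Fin 2 → Fin 4 := ![![1, 3], ![2, 1], ![3, 2]] with hσ₂
  set τ₁ : Fin 3 → Fin 2 → Fin 4 := ![![0, 3], ![0, 1], ![0, 2]] with hτ₁
  set τ₂ : Fin 3 → Fin 2 → Fin 4 := ![![1, 2], ![2, 3], ![3, 1]] with hτ₂
  set MA : (Fin 4 → Fin 4 → Fin 4 → Fin 4 → ℝ) → Matrix (Fin 3) (Fin 3) ℝ := fun R ↦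
    Matrix.of fun i j ↦ ∑ a, ∑ b, R (σ₁ i a) (σ₂ i a) (σ₂ j b) (σ₁ j b) with hMA
  set MB : (Fin 4 → Fin 4 → Fin 4 → Fin 4 → ℝ) → Matrix (Fin 3) (Fin 3) ℝ := fun R ↦
    Matrix.of fun i j ↦ ∑ a, ∑ b, R (σ₁ i a) (σ₂ i a) (τ₂ j b) (τ₁ j b) with hMB
  set MC : (Fin 4 → Fin 4 → Fin 4 → Fin 4 → ℝ) → Matrix (Fin 3) (Fin 3) ℝ := fun R ↦
    Matrix.of fun i j ↦ ∑ a, ∑ b, R (τ₁ i a) (τ₂ i a) (τ₂ j b) (τ₁ j b) with hMC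
  have hA : ∀ (x : M) (e : Fin 4 → TangentSpace I x),
      MA (fun a b c d ↦ g.curvatureForm cov x (e a) (e b) (e c) (e d)) = g.blockA cov x e := by
    intro x e; ext i j
    fin_cases i <;> fin_cases j <;>
      simp [hMA, hσ₁, hσ₂, blockA, pairingCurvature, bivectorCurvature, selfDualPairs, Fin.sum_univ_two]
  have hB : ∀ (x : M) (e : Fin 4 → TangentSpace I x),
      MB (fun a b c d ↦ g.curvatureForm cov x (e a) (e b) (e c) (e d)) = g.blockB cov x e := by
    intro x e; ext i j
    fin_cases i <;> fin_cases j <;>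
      simp [hMB, hσ₁, hσ₂, hτ₁, hτ₂, blockB, pairingCurvature, bivectorCurvature, selfDualPairs,
        antiSelfDualPairs, Fin.sum_univ_two]
  have hC : ∀ (x : M) (e : Fin 4 → TangentSpace I x),
      MC (fun a b c d ↦ g.curvatureForm cov x (e a) (e b) (e c) (e d)) = g.blockC cov x e := by
    intro x e; ext i j
    fin_cases i <;> fin_cases j <;>
      simp [hMC, hτ₁, hτ₂, blockC, pairingCurvature, bivectorCurvature, antiSelfDualPairs, Fin.sum_univ_two]
  -- the functional `1/(1 + |uᵀAv| + |uᵀBv| + |uᵀCv|)`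
  set S : (Fin 4 → Fin 4 → Fin 4 → Fin 4 → ℝ) → (Fin 3 → ℝ) × (Fin 3 → ℝ) → ℝ := fun R y ↦
    |y.1 ⬝ᵥ (MA R *ᵥ y.2)| + |y.1 ⬝ᵥ (MB R *ᵥ y.2)| + |y.1 ⬝ᵥ (MC R *ᵥ y.2)| with hS
  set F : (Fin 4 → Fin 4 → Fin 4 → Fin 4 → ℝ) → (Fin 3 → ℝ) × (Fin 3 → ℝ) → ℝ := fun R y ↦
    1 / (1 + S R y) with hF
  have hRcont : ∀ a b c d : Fin 4,
      Continuous fun R : Fin 4 → Fin 4 → Fin 4 → Fin 4 → ℝ ↦ R a b c d := fun a b c d ↦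
    (continuous_apply d).comp ((continuous_apply c).comp ((continuous_apply b).comp (continuous_apply a)))
  have hMcont : ∀ {Mx : (Fin 4 → Fin 4 → Fin 4 → Fin 4 → ℝ) → Matrix (Fin 3) (Fin 3) ℝ}
      (ι₁ ι₂ ι₃ ι₄ : Fin 3 → Fin 2 → Fin 4),
      Mx = (fun R ↦ Matrix.of fun i j ↦ ∑ a, ∑ b, R (ι₁ i a) (ι₂ i a) (ι₃ j b) (ι₄ j b)) →
      Continuous Mx := by
    intro Mx ι₁ ι₂ ι₃ ι₄ hMx
    subst hMx
    refine continuous_matrix fun i j ↦ ?_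
    change Continuous fun R : Fin 4 → Fin 4 → Fin 4 → Fin 4 → ℝ ↦ ∑ a, ∑ b, R (ι₁ i a) (ι₂ i a) (ι₃ j b) (ι₄ j b)
    exact continuous_finsetSum _ fun a _ ↦ continuous_finsetSum _ fun b _ ↦ hRcont _ _ _ _
  have hMAcont : Continuous MA := hMcont σ₁ σ₂ σ₂ σ₁ rfl
  have hMBcont : Continuous MB := hMcont σ₁ σ₂ τ₂ τ₁ rfl
  have hMCcont : Continuous MC := hMcont τ₁ τ₂ τ₂ τ₁ rfl
  have hbil : ∀ {Mx : (Fin 4 → Fin 4 → Fin 4 → Fin 4 → ℝ) → Matrix (Fin 3) (Fin 3) ℝ}, Continuous Mx →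
      Continuous fun p : (Fin 4 → Fin 4 → Fin 4 → Fin 4 → ℝ) × ((Fin 3 → ℝ) × (Fin 3 → ℝ)) ↦
        |p.2.1 ⬝ᵥ (Mx p.1 *ᵥ p.2.2)| := fun hMx ↦
    ((continuous_fst.comp continuous_snd).dotProduct
      ((hMx.comp continuous_fst).matrix_mulVec (continuous_snd.comp continuous_snd))).abs
  have hScont : Continuous (uncurry S) := ((hbil hMAcont).add (hbil hMBcont)).add (hbil hMCcont)
  have hSnn : ∀ R y, 0 ≤ S R y := fun R y ↦ by positivity
  have hFcont : Continuous (uncurry F) := by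
    have h1 : Continuous fun p : (Fin 4 → Fin 4 → Fin 4 → Fin 4 → ℝ) × ((Fin 3 → ℝ) × (Fin 3 → ℝ)) ↦
        1 + uncurry S p := continuous_const.add hScont
    exact continuous_const.div h1 fun p ↦ by have := hSnn p.1 p.2; change 1 + S p.1 p.2 ≠ 0; linarith
  set K : Set ((Fin 3 → ℝ) × (Fin 3 → ℝ)) := {y | y.1 ⬝ᵥ y.1 = 1 ∧ y.2 ⬝ᵥ y.2 = 1} with hK
  have hKc : IsCompact K := by
    have : K = unitSet ×ˢ unitSet := by ext y; simp [hK, unitSet, Set.mem_prod]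
    rw [this]; exact isCompact_unitSet.prod isCompact_unitSet
  have hpos : ∀ (x : M) (e : Fin 4 → TangentSpace I x), g.IsOrthonormalFrame x e → ∀ y ∈ K,
      0 < F (fun a b c d ↦ g.curvatureForm cov x (e a) (e b) (e c) (e d)) y := by
    intro x e _ y _
    simp only [hF]
    exact div_pos one_pos (by linarith [hSnn (fun a b c d ↦ g.curvatureForm cov x (e a) (e b) (e c) (e d)) y])
  obtain ⟨m, hm, hmle⟩ := exists_pos_le_curvatureFunctional hg hcov hKc hFcont.continuousOn hpos
  refine ⟨max (1 / m - 1) 0, le_max_right _ _, fun x e he u v hu hv ↦ ?_⟩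
  have h := hmle x e he (u, v) ⟨hu, hv⟩
  have hSR : S (fun a b c d ↦ g.curvatureForm cov x (e a) (e b) (e c) (e d)) (u, v) =
      |u ⬝ᵥ (g.blockA cov x e *ᵥ v)| + |u ⬝ᵥ (g.blockB cov x e *ᵥ v)| +
        |u ⬝ᵥ (g.blockC cov x e *ᵥ v)| := by
    simp only [hS, hA x e, hB x e, hC x e]
  simp only [hF, hSR] at h
  have h1 := abs_nonneg (u ⬝ᵥ (g.blockA cov x e *ᵥ v))
  have h2 := abs_nonneg (u ⬝ᵥ (g.blockB cov x e *ᵥ v))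
  have h3 := abs_nonneg (u ⬝ᵥ (g.blockC cov x e *ᵥ v))
  have hSpos : 0 < 1 + (|u ⬝ᵥ (g.blockA cov x e *ᵥ v)| + |u ⬝ᵥ (g.blockB cov x e *ᵥ v)| +
      |u ⬝ᵥ (g.blockC cov x e *ᵥ v)|) := by linarith
  rw [le_div_iff₀ hSpos] at h
  have hbound : |u ⬝ᵥ (g.blockA cov x e *ᵥ v)| + |u ⬝ᵥ (g.blockB cov x e *ᵥ v)| +
      |u ⬝ᵥ (g.blockC cov x e *ᵥ v)| ≤ 1 / m - 1 := by
    rw [le_sub_iff_add_le, le_div_iff₀ hm]; linarith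
  exact ⟨le_max_of_le_left (by linarith), le_max_of_le_left (by linarith), le_max_of_le_left (by linarith)⟩

/-- **Uniform bound on the curvature blocks, uniformly over Levi-Civita connections** (the
`hbd` hypothesis of `hamilton_chenZhu_pinching_of_ode₄`). [cite: Hamilton1997, §2.2, p. 17] -/
theorem exists_blocks_bound (hg : g.IsRiemannian) :
    ∃ K₀ : ℝ, 0 ≤ K₀ ∧ ∀ (cov : CovariantDerivative I E (TangentSpace I : M → Type _)),
      g.IsLeviCivita cov → ∀ (x : M) (e : Fin 4 → TangentSpace I x), g.IsOrthonormalFrame x e →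
      ∀ u v : Fin 3 → ℝ, u ⬝ᵥ u = 1 → v ⬝ᵥ v = 1 →
        |u ⬝ᵥ (g.blockA cov x e *ᵥ v)| ≤ K₀ ∧ |u ⬝ᵥ (g.blockB cov x e *ᵥ v)| ≤ K₀ ∧
          |u ⬝ᵥ (g.blockC cov x e *ᵥ v)| ≤ K₀ := by
  by_cases hex : ∃ cov : CovariantDerivative I E (TangentSpace I : M → Type _), g.IsLeviCivita cov
  · obtain ⟨cov₀, hcov₀⟩ := hex
    obtain ⟨K₀, hK₀, hle⟩ := exists_blocks_bound_with hg hcov₀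
    refine ⟨K₀, hK₀, fun cov hcov x e he u v hu hv ↦ ?_⟩
    obtain ⟨hA, hB, hC⟩ := blocks_eq_of_isLeviCivita hcov₀ hcov x e
    rw [hA, hB, hC]
    exact hle x e he u v hu hv
  · exact ⟨0, le_rfl, fun cov hcov ↦ (hex ⟨cov, hcov⟩).elim⟩

/-- **Uniform `a₁ + a₂ ≥ m`, `c₁ + c₂ ≥ m` on a compact PIC manifold, uniformly over
Levi-Civita connections** (the `hpic` hypothesis of `hamilton_chenZhu_pinching_of_ode₄`).
[cite: Hamilton1997, §2.1, p. 8] -/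
theorem exists_pic_bound (hg : g.IsRiemannian) (hPIC : g.HasPositiveIsotropicCurvature) :
    ∃ m : ℝ, 0 < m ∧ ∀ (cov : CovariantDerivative I E (TangentSpace I : M → Type _)),
      g.IsLeviCivita cov → ∀ (x : M) (e : Fin 4 → TangentSpace I x), g.IsOrthonormalFrame x e →
        (g.blockA cov x e).TwoSmallestEigenvaluesSumGE m ∧ (g.blockC cov x e).TwoSmallestEigenvaluesSumGE m := by
  by_cases hex : ∃ cov : CovariantDerivative I E (TangentSpace I : M → Type _), g.IsLeviCivita cov
  · obtain ⟨cov₀, hcov₀⟩ := hex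
    obtain ⟨m, hm, hle⟩ := exists_pos_le_twoSmallestEigenvaluesSum_blocks hg hcov₀ (hPIC cov₀ hcov₀)
    refine ⟨m, hm, fun cov hcov x e he ↦ ?_⟩
    obtain ⟨hA, -, hC⟩ := blocks_eq_of_isLeviCivita hcov₀ hcov x e
    rw [hA, hC]
    exact ⟨fun u v hu hv huv ↦ (hle x e he u v hu hv huv).1, fun u v hu hv huv ↦ (hle x e he u v hu hv huv).2⟩
  · exact ⟨1, one_pos, fun cov hcov ↦ (hex ⟨cov, hcov⟩).elim⟩

end General

/-! ### The reduction with the compactness hypotheses discharged -/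

universe u

/-- **Chen–Zhu 2006, Lemma 2.1 from the maximum principle for the curvature ODE and the ODE parts
of Hamilton 1997, Thms. 2.1 and 2.3** — `hamilton_chenZhu_pinching_of_ode₄` with the two
compactness statements on the initial metric supplied by `exists_blocks_bound` and
`exists_pic_bound`. [cite: ChenZhu2006, §2, Lemma 2.1] [cite: Hamilton1997, §2, Thm. 1.1 (proof, pp. 7–21)] -/
theorem hamilton_chenZhu_pinching_of_ode₂ (hMP : hamilton_maximumPrinciple_curvatureODE.{u})
    (h21 : ∀ m Λ Ξ : ℝ, 0 < m → 0 < Λ → 0 < Ξ → ∃ K₀ : ℝ, ∀ K : ℝ, K₀ ≤ K → 0 ≤ K →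
      IsInvariantRel field
        (fun _ ↦ {p | (p.1.IsSymm ∧ p.2.2.IsSymm) ∧ p.1.TwoSmallestEigenvaluesSumGE m ∧
          p.2.2.TwoSmallestEigenvaluesSumGE m ∧ SingularValuesSumSqLE p Λ ∧
          MaxLEPairSum p Ξ ∧ p.1.trace = p.2.2.trace})
        (fun _ ↦ {p | ImprovedPinching p K}))
    (h23 : ∀ m Λ Ξ ρ Ω K : ℝ, 0 < m → 0 < Λ → 0 < Ξ → 0 < ρ → 0 < Ω →
      ∃ Q : ℝ, 2 ≤ Q ∧ ∃ L₀ P₀ : ℝ, ∀ L P : ℝ, L₀ ≤ L → P₀ ≤ P → 0 < L → 0 < P →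
        IsInvariantRel field
          (fun t ↦ {p | (p.1.IsSymm ∧ p.2.2.IsSymm) ∧ p.1.TwoSmallestEigenvaluesSumGE m ∧
            p.2.2.TwoSmallestEigenvaluesSumGE m ∧ SingularValuesSumSqLE p Λ ∧
            MaxLEPairSum p Ξ ∧ p.1.trace = p.2.2.trace ∧
            Matrix.PinchedBy p.1 p.2.1 p.2.2 ρ Ω ∧ ImprovedPinching p K ∧
            SingularValueLEExp p (L / 2) P ρ t})
          (fun t ↦ {p | ImprovedPinchingQ p ρ L P Q t})) :
    hamilton_chenZhu_pinching.{u} := by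
  refine hamilton_chenZhu_pinching_of_ode₄ hMP h21 h23 (fun M _ _ _ _ _ _ g hg ↦ ?_)
    (fun M _ _ _ _ _ _ g hg hPIC ↦ ?_)
  · haveI : LocallyCompactSpace M := ChartedSpace.locallyCompactSpace (EuclideanSpace ℝ (Fin 4)) M
    exact exists_blocks_bound hg
  · haveI : LocallyCompactSpace M := ChartedSpace.locallyCompactSpace (EuclideanSpace ℝ (Fin 4)) M
    exact exists_pic_bound hg hPIC

end Literature.Geometry.Riemannian

end
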